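import Summits.NavierStokesRegularity.NavierStokesRegularity.Theorems.ExtremiserTransienceNearExtremalTransienceExtremiserLiouvilleConstantSpeedSlideQuotientBounds
import Summits.NavierStokesRegularity.NavierStokesRegularity.Theorems.ExtremiserTransienceNearExtremalTransienceExtremiserLiouvilleConstantSpeedSlideQuotientL2
import Summits.NavierStokesRegularity.NavierStokesRegularity.Theorems.ExtremiserTransienceNearExtremalTransienceExtremiserLiouvilleConstantSpeedConvexKKT
import HarnessLib

/-!
# Crux `ExtremiserTransience.NearExtremalTransience` (stmt-NavierStokesRegularity-21883), line `extremiser_liouville`,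
# stub K1b — **KKT ALONG THE DISCRETE SLIDE**: `ℓ(φ̂_h) ≥ 0` for every far layer and every `h ≥ 0` (blueprint L2)

`--supports stmt-NavierStokesRegularity-21883` (helper).  Author: prover seat `ns-el-k1b` (g8).  Record:
`Cruxes/NearExtremalTransience/Lines/extremiser_liouville_k1b_slide.md` §1, §11 (L2).

THE RESULT.  `v` a constant-speed extended extremiser (`‖v‖ ≡ M`, `C^∞`, divergence free, `‖Dv‖ ≤ B`, `D¹v, D²v ∈ L²`,
`|S| = κ⋆M√Z√W`), `c = (0,0,c₂)` with `‖c‖ = M` (far-field constant, axis normalised), `V = v − c`; a LAYER PROFILE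
`g ∈ C^∞`, `g, g′ ≥ 0`, `g, g′, g″, g‴` bounded, `g′ = g″ = g‴ = 0` off `[−T, T]`, the slab `{|x₂| ≤ T}` square integrable for
`V` and `‖V‖² ≤ 2M²` on the thickened layer `{|x₂| ≤ T + h}` (far field).  Then for the discrete slide direction
`φ̂_h = g(x₂)V − g(x₂−h)V(·−he₂) − (∫_{−h}^0 g′(x₂+t)V₂(·+te₂)dt)e₂` (`…SlideQuotient`) the global KKT inequality
`ext_firstVariation_le_of_inner_le_global` applies to `ψ = −h⁻¹φ̂_h` (`h > 0`) with `s = 0` (`⟪v, ψ⟫ = −⟪c+V, φ̂_h⟫ ≤ 0`,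
`inner_slideQuotient_nonneg_of_farLayer`), all class conditions being supplied by `…SlideQuotient(Bounds|L2)`:
* `slideKKT` : **`S·J₁(−h⁻¹φ̂_h) ≤ κ⋆²M²·(W·a₁(−h⁻¹φ̂_h) + Z·c₁(−h⁻¹φ̂_h))`**, i.e. `ℓ(h⁻¹φ̂_h) ≥ 0` — with NO `h`-error
  and NO `D³V` (the normalisation `h⁻¹` makes `−h⁻¹φ̂_h → −φ_g`, ready for the limit).
Letting `h → 0⁺` (translation continuity in `L²`, next files) gives the slide inequality (INEQ) of the
record with the regularised `c₁` (discrete product rule `…DiscreteProductRule`, favourable-sign remainders dropped).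

WHAT THIS IS NOT: K1b is NOT proved; nothing here proves NS regularity. [folklore]
-/

noncomputable section

open Set Filter Topology MeasureTheory Metric Function InnerProductSpace
open scoped ENNReal NNReal Topology InnerProductSpace RealInnerProductSpace ContDiff
open Literature.Analysis.FluidPDE Literature.Analysis

namespace Summit.NavierStokesRegularity.NavierStokesRegularity.Theorems

-- the problem directory repeats the summit name (`NavierStokesRegularity/NavierStokesRegularity`)
set_option linter.dupNamespace false

namespace ExtremiserLiouville

open DepletionLadder.KStar

variable {v : EuclideanSpace ℝ (Fin 3) → EuclideanSpace ℝ (Fin 3)} {c : EuclideanSpace ℝ (Fin 3)} {g : ℝ → ℝ}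

/-- For `‖v‖ ≡ ‖c‖`: `⟪v − c, c⟫ = −‖v − c‖²/2`. [folklore] -/
theorem inner_sub_const_eq_of_norm_eq (hM : ∀ x, ‖v x‖ = ‖c‖) (y : EuclideanSpace ℝ (Fin 3)) :
    ⟪v y - c, c⟫ = -(‖v y - c‖ ^ 2 / 2) := by
  have h1 : ‖v y - c‖ ^ 2 = ‖v y‖ ^ 2 - 2 * ⟪v y, c⟫ + ‖c‖ ^ 2 := norm_sub_sq_real _ _
  rw [inner_sub_left, real_inner_self_eq_norm_sq, hM y] at *
  linarith

/-- Constant multiples of a divergence-free field are divergence free. [folklore] -/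
theorem isDivFree_const_smul {φ : EuclideanSpace ℝ (Fin 3) → EuclideanSpace ℝ (Fin 3)} (hφd : Differentiable ℝ φ)
    (hφ : VectorCalculus.IsDivFree φ) (a : ℝ) : VectorCalculus.IsDivFree fun x => a • φ x := by
  intro x
  have e : (fun y => a • φ y) = fun y => (fun _ : EuclideanSpace ℝ (Fin 3) => (0 : EuclideanSpace ℝ (Fin 3))) y + a • φ y := by
    funext y; simp
  have h0 : VectorCalculus.divergence (fun _ : EuclideanSpace ℝ (Fin 3) => (0 : EuclideanSpace ℝ (Fin 3))) x = 0 := by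
    rw [divergence_eq_sum_three]; simp
  rw [e, divergence_add_smul (differentiable_const _) hφd, hφ x, h0]; ring

/-- **KKT ALONG THE DISCRETE SLIDE.**  For a constant-speed extended extremiser `v` with axis-normalised far field `c`
(`c = (0,0,c₂)`, `‖c‖ = M`), a layer profile `g` (`C^∞`, `g, g′ ≥ 0`, `g…g‴` bounded, `g′, g″, g‴ = 0` off `[−T,T]`), a
square-integrable slab `{|x₂| ≤ T}` and the far-field condition `‖v − c‖² ≤ 2M²` on `{|x₂| ≤ T + h}` (`h ≥ 0`):
`S·J₁(ψ) ≤ κ⋆²M²(W a₁(ψ) + Z c₁(ψ))` for `ψ = −h⁻¹φ̂_h` (`h > 0`), i.e. **`ℓ(h⁻¹φ̂_h) ≥ 0`** exactly. [folklore] -/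
theorem slideKKT
    (hv : ContDiff ℝ ∞ v) (hdiv : VectorCalculus.IsDivFree v) {M B : ℝ} (hMpos : 0 < M)
    (hM : ∀ x, ‖v x‖ = M) (hB : ∀ x, ‖fderiv ℝ v x‖ ≤ B)
    (h1 : ∫⁻ x, ‖iteratedFDeriv ℝ 1 v x‖ₑ ^ 2 < ⊤) (h2 : ∫⁻ x, ‖iteratedFDeriv ℝ 2 v x‖ₑ ^ 2 < ⊤)
    (hatt : |∫ x, ⟪curl v x, fderiv ℝ v x (curl v x)⟫| = (sInf {κ : ℝ | (∀ (v : EuclideanSpace ℝ (Fin 3) → EuclideanSpace ℝ (Fin 3)) (M B : ℝ), ContDiff ℝ (⊤ : ℕ∞) v → Literature.Analysis.FluidPDE.VectorCalculus.IsDivFree v → (∀ x, ‖v x‖ ≤ M) → (∀ x, ‖fderiv ℝ v x‖ ≤ B) → (∫⁻ x, ‖iteratedFDeriv ℝ 0 v x‖ₑ ^ 2 < ⊤) → (∫⁻ x, ‖iteratedFDeriv ℝ 1 v x‖ₑ ^ 2 < ⊤) → (∫⁻ x, ‖iteratedFDeriv ℝ 2 v x‖ₑ ^ 2 < ⊤)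 → |∫ x, ⟪Literature.Analysis.FluidPDE.curl v x, fderiv ℝ v x (Literature.Analysis.FluidPDE.curl v x)⟫_ℝ| ≤ κ * M * Real.sqrt (∫ x, ‖Literature.Analysis.FluidPDE.curl v x‖ ^ 2) * Real.sqrt (∫ x, Literature.Analysis.FluidPDE.frobeniusNormSq (fderiv ℝ (Literature.Analysis.FluidPDE.curl v) x)))}) * M * Real.sqrt (∫ x, ‖curl v x‖ ^ 2) * Real.sqrt (∫ x, frobeniusNormSq (fderiv ℝ (curl v) x)))
    (hc0 : c 0 = 0) (hc1 : c 1 = 0) (hcM : ‖c‖ = M)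
    (hg : ContDiff ℝ ∞ g) {T K0 K1 K2 K3 : ℝ}
    (hK0 : ∀ s, |g s| ≤ K0) (hK1 : ∀ s, |deriv g s| ≤ K1) (hK2 : ∀ s, |deriv (deriv g) s| ≤ K2)
    (hK3 : ∀ s, |deriv (deriv (deriv g)) s| ≤ K3)
    (hT1 : ∀ s, T < |s| → deriv g s = 0) (hT2 : ∀ s, T < |s| → deriv (deriv g) s = 0)
    (hT3 : ∀ s, T < |s| → deriv (deriv (deriv g)) s = 0)
    (hg0 : ∀ s, 0 ≤ g s) (hγ0 : ∀ s, 0 ≤ deriv g s)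
    (hslab : Integrable (fun x => {x : EuclideanSpace ℝ (Fin 3) | |x 2| ≤ T}.indicator (fun x => ‖v x - c‖ ^ 2) x) volume)
    {h : ℝ} (hh : 0 < h) (hfar : ∀ x : EuclideanSpace ℝ (Fin 3), |x 2| ≤ T + h → ‖v x - c‖ ^ 2 ≤ 2 * M ^ 2) :
    (∫ x, ⟪curl v x, fderiv ℝ v x (curl v x)⟫) *
        (∫ x, (⟪curl (fun x => (-h⁻¹) • (g (x 2) • (v x - c) - g ((x + (-h) • EuclideanSpace.single (2 : Fin 3) (1 : ℝ)) 2) •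
            (v (x + (-h) • EuclideanSpace.single (2 : Fin 3) (1 : ℝ)) - c) -
          (∫ t in (-h)..0, deriv g ((x + t • EuclideanSpace.single (2 : Fin 3) (1 : ℝ)) 2) *
              (v (x + t • EuclideanSpace.single (2 : Fin 3) (1 : ℝ)) - c) 2) • EuclideanSpace.single (2 : Fin 3) (1 : ℝ))) x, fderiv ℝ v x (curl v x)⟫ +
          ⟪curl v x, fderiv ℝ (fun x => (-h⁻¹) • (g (x 2) • (v x - c) - g ((x + (-h) • EuclideanSpace.single (2 : Fin 3) (1 : ℝ)) 2) •
            (v (x + (-h) • EuclideanSpace.single (2 : Fin 3) (1 : ℝ)) - c) -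
          (∫ t in (-h)..0, deriv g ((x + t • EuclideanSpace.single (2 : Fin 3) (1 : ℝ)) 2) *
              (v (x + t • EuclideanSpace.single (2 : Fin 3) (1 : ℝ)) - c) 2) • EuclideanSpace.single (2 : Fin 3) (1 : ℝ))) x (curl v x)⟫ +
          ⟪curl v x, fderiv ℝ v x (curl (fun x => (-h⁻¹) • (g (x 2) • (v x - c) - g ((x + (-h) • EuclideanSpace.single (2 : Fin 3) (1 : ℝ)) 2) •
            (v (x + (-h) • EuclideanSpace.single (2 : Fin 3) (1 : ℝ)) - c) -
          (∫ t in (-h)..0, deriv g ((x + t • EuclideanSpace.single (2 : Fin 3) (1 : ℝ)) 2) *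
              (v (x + t • EuclideanSpace.single (2 : Fin 3) (1 : ℝ)) - c) 2) • EuclideanSpace.single (2 : Fin 3) (1 : ℝ))) x)⟫)) ≤
      (sInf {κ : ℝ | (∀ (v : EuclideanSpace ℝ (Fin 3) → EuclideanSpace ℝ (Fin 3)) (M B : ℝ), ContDiff ℝ (⊤ : ℕ∞) v → Literature.Analysis.FluidPDE.VectorCalculus.IsDivFree v → (∀ x, ‖v x‖ ≤ M) → (∀ x, ‖fderiv ℝ v x‖ ≤ B) → (∫⁻ x, ‖iteratedFDeriv ℝ 0 v x‖ₑ ^ 2 < ⊤) → (∫⁻ x, ‖iteratedFDeriv ℝ 1 v x‖ₑ ^ 2 < ⊤) → (∫⁻ x, ‖iteratedFDeriv ℝ 2 v x‖ₑ ^ 2 < ⊤) → |∫ x, ⟪Literature.Analysis.FluidPDE.curl v x, fderiv ℝ v x (Literature.Analysis.FluidPDE.curl v x)⟫_ℝ| ≤ κ * M * Real.sqrt (∫ x, ‖Literature.Analysis.FluidPDE.curl v x‖ ^ 2) * Real.sqrt (∫ x, Literature.Analysis.FluidPDE.frobeniusNormSq (fderiv ℝ (Literature.Analysis.FluidPDE.curl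 v) x)))}) ^ 2 * M ^ 2 *
        ((∫ x, frobeniusNormSq (fderiv ℝ (curl v) x)) * (∫ x, ⟪curl v x, curl (fun x => (-h⁻¹) • (g (x 2) • (v x - c) - g ((x + (-h) • EuclideanSpace.single (2 : Fin 3) (1 : ℝ)) 2) •
            (v (x + (-h) • EuclideanSpace.single (2 : Fin 3) (1 : ℝ)) - c) -
          (∫ t in (-h)..0, deriv g ((x + t • EuclideanSpace.single (2 : Fin 3) (1 : ℝ)) 2) *
              (v (x + t • EuclideanSpace.single (2 : Fin 3) (1 : ℝ)) - c) 2) • EuclideanSpace.single (2 : Fin 3) (1 : ℝ))) x⟫) +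
          (∫ x, ‖curl v x‖ ^ 2) * (∫ x, ∑ i, ⟪fderiv ℝ (curl v) x (EuclideanSpace.basisFun (Fin 3) ℝ i),
            fderiv ℝ (curl (fun x => (-h⁻¹) • (g (x 2) • (v x - c) - g ((x + (-h) • EuclideanSpace.single (2 : Fin 3) (1 : ℝ)) 2) •
            (v (x + (-h) • EuclideanSpace.single (2 : Fin 3) (1 : ℝ)) - c) -
          (∫ t in (-h)..0, deriv g ((x + t • EuclideanSpace.single (2 : Fin 3) (1 : ℝ)) 2) *
              (v (x + t • EuclideanSpace.single (2 : Fin 3) (1 : ℝ)) - c) 2) • EuclideanSpace.single (2 : Fin 3) (1 : ℝ)))) x (EuclideanSpace.basisFun (Fin 3) ℝ i)⟫)) := by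
  set e₂ : EuclideanSpace ℝ (Fin 3) := EuclideanSpace.single (2 : Fin 3) (1 : ℝ) with he₂
  set V : EuclideanSpace ℝ (Fin 3) → EuclideanSpace ℝ (Fin 3) := fun y => v y - c with hVdef
  set φ : EuclideanSpace ℝ (Fin 3) → EuclideanSpace ℝ (Fin 3) := fun x =>
    g (x 2) • V x - g ((x + (-h) • e₂) 2) • V (x + (-h) • e₂) -
      (∫ t in (-h)..0, deriv g ((x + t • e₂) 2) * V (x + t • e₂) 2) • e₂ with hφdef
  -- the residue field `V = v − c`
  have hVs : ContDiff ℝ ∞ V := hv.sub contDiff_const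
  have hV1 : ContDiff ℝ 1 V := hVs.of_le (WithTop.coe_le_coe.mpr le_top)
  have hvd : Differentiable ℝ v := hv.differentiable (by simp)
  have hVdiv : VectorCalculus.IsDivFree V := isDivFree_sub_const hdiv c
  have hMc : ∀ x, ‖v x‖ = ‖c‖ := fun x => by rw [hM x, hcM]
  have hVc : ∀ y, ⟪V y, c⟫ = -(‖V y‖ ^ 2 / 2) := fun y => inner_sub_const_eq_of_norm_eq hMc y
  have hcpos : 0 < ‖c‖ := by rw [hcM]; exact hMpos
  have hDV : ∀ x, fderiv ℝ V x = fderiv ℝ v x := fun x => by simp only [hVdef]; rw [fderiv_sub_const]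
  have hVB : ∀ x, ‖fderiv ℝ V x‖ ≤ B := fun x => by rw [hDV]; exact hB x
  have hVn : ∀ x, ‖V x‖ ≤ 2 * M := fun x =>
    (norm_sub_le (v x) c).trans (by rw [hM, hcM]; linarith)
  have hVk : ∀ k : ℕ, k ≠ 0 → (∫⁻ x, ‖iteratedFDeriv ℝ k v x‖ₑ ^ 2 < ⊤) → ∫⁻ x, ‖iteratedFDeriv ℝ k V x‖ₑ ^ 2 < ⊤ := by
    intro k hk hkv
    have e : (fun x => ‖iteratedFDeriv ℝ k V x‖ₑ ^ 2) = fun x => ‖iteratedFDeriv ℝ k v x‖ₑ ^ 2 := by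
      funext x; rw [iteratedFDeriv_sub_const_of_ne hv c hk]
    rw [e]; exact hkv
  have hg2 : ContDiff ℝ 2 g := hg.of_le (WithTop.coe_le_coe.mpr le_top)
  have hgd : Differentiable ℝ g := hg.differentiable (by simp)
  -- the direction `ψ = −φ̂_h` and its class conditions
  have hφs : ContDiff ℝ ∞ φ := contDiff_slideQuotient hVs hg h
  have hφd : Differentiable ℝ φ := hφs.differentiable (by simp)
  have hφdiv : VectorCalculus.IsDivFree φ := isDivFree_slideQuotient hV1 hVdiv hg2 h
  set a : ℝ := -h⁻¹ with ha
  have hψs : ContDiff ℝ ∞ fun x => a • φ x := hφs.const_smul a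
  have hψdiv : VectorCalculus.IsDivFree fun x => a • φ x := isDivFree_const_smul hφd hφdiv a
  obtain hbd := fun x => norm_slideQuotient_le hV1 hg2 hK0 hK1 hK2 hVn hVB h x
  have hP : ∀ x, ‖a • φ x‖ ≤ |a| * (2 * (K0 * (2 * M)) + |h| * (K1 * (2 * M))) := fun x => by
    rw [norm_smul, Real.norm_eq_abs]; exact mul_le_mul_of_nonneg_left (hbd x).1 (abs_nonneg _)
  have hC : ∀ x, ‖fderiv ℝ (fun x => a • φ x) x‖ ≤ |a| * (2 * (K0 * B + K1 * (2 * M)) + |h| * (K1 * B + K2 * (2 * M))) :=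
    fun x => by
    have hD : fderiv ℝ (fun x => a • φ x) x = a • fderiv ℝ φ x := ((hφd x).hasFDerivAt.const_smul a).fderiv
    rw [hD, norm_smul, Real.norm_eq_abs]
    exact mul_le_mul_of_nonneg_left (hbd x).2 (abs_nonneg _)
  obtain ⟨hL1, hL2⟩ := lintegral_iteratedFDeriv_slideQuotient_lt_top hVs hg hK0 hK1 hK2 hK3 hT1 hT2 hT3
    (hVk 1 one_ne_zero h1) (hVk 2 two_ne_zero h2) hslab hh.le
  have hsm : ∀ k : ℕ, (∫⁻ x, ‖iteratedFDeriv ℝ k φ x‖ₑ ^ 2 < ⊤) →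
      ∫⁻ x, ‖iteratedFDeriv ℝ k (fun x => a • φ x) x‖ₑ ^ 2 < ⊤ := by
    intro k hk
    have e : (fun x => ‖iteratedFDeriv ℝ k (fun x => a • φ x) x‖ₑ ^ 2) = fun x => ‖a‖ₑ ^ 2 * ‖iteratedFDeriv ℝ k φ x‖ₑ ^ 2 := by
      funext x
      rw [iteratedFDeriv_const_smul_apply' ((hφs.of_le (WithTop.coe_le_coe.mpr le_top)).contDiffAt (x := x)),
        enorm_smul, mul_pow]
    rw [e, lintegral_const_mul' _ _ (by simp)]
    exact ENNReal.mul_lt_top (by simp) hk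
  have hs : ∀ x, ⟪v x, a • φ x⟫ ≤ 0 := fun x => by
    have hx := inner_slideQuotient_nonneg_of_farLayer (V := V) (g := g) hVc hc0 hc1 hcpos hgd hg0 hγ0 hh.le hT1
      (fun y hy => by rw [hcM]; exact hfar y hy) x
    have ev : v x = c + V x := by simp [hVdef]
    have ha0 : a ≤ 0 := by rw [ha, neg_nonpos]; exact inv_nonneg.2 hh.le
    rw [real_inner_smul_right, ev]
    exact mul_nonpos_of_nonpos_of_nonneg ha0 hx
  have key := ext_firstVariation_le_of_inner_le_global hv hdiv hMpos hM hB h1 h2 hatt hψs hψdiv hP hC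
    (hsm 1 hL1) (hsm 2 hL2) hs
  rw [zero_div, zero_mul, zero_mul, zero_add] at key
  exact key

end ExtremiserLiouville

end Summit.NavierStokesRegularity.NavierStokesRegularity.Theorems

end
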